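import Summits.QuantumFields.BalabanUV.Beta.GAN24.LayerLetterRotated

/-!
# `BalabanUV.Beta.GAN24.LayerLetterMixed` — binder row G-an2-4 ∕ (CONV-C), W-slot CT-W, route «WC-TL» ∕ (Q-R) «QR-LL», row (LAY), programme
# «(LAY-LIT) THE LITERAL's LETTER PROFILE ROWS `hS ∧ hω` OF THE (Q-R) END», PART 3:
# **THE MIXED-REMAINDER PIECE (β) SUMMED OVER THE LABELS OF A SUPER-BLOCK IS A FACE LETTER AT THE SLOT** — `vertexOfM G` of «flux over the fine union
# minus the commutator with the union's generator» is `BiLoc` at `N•y′` with constant `C·FW_U^{δ∕3}(N•y′)`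
# (G-an2-4 formalisation swarm → CRUX TEAM (2), leaf prover `b2b-balaban-gan24-formalise-leaf-03`, gen 61; INTENT 3, journal `CLAIMS.log`; names PROVISIONAL)

NOT IN PRINT; OUR BOOKKEEPING ([folklore] the `cwsum` calculus (`InterLevelTransport.biLoc_cwsum`) over p2 g37's `WardResidualLabelSums.sum_remainder_of_tableLaw ∕
vertexOfM_finset_sum`, leaf-06 g44's `GaugeReadLayerForm.sum_sum_box_eq_sum_biUnion` and PART 1's general-anchor letters `LayerLetterFaces.biLoc_finsetSum_divV_anchor ∕
biLoc_comm_diagK_legInd_of_faceBound ∕ faceW_reanchor` BY NAME; generic `d`, GENERIC `G ∕ M1 ∕ M2 ∕ RM ∕ T` — no object of an2's typed system; 0 `def`, 0 cited facts,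
0 `def … : Prop`, 0 sorry).  HONEST FRAMING (cell contract, verbatim): «discharging `BetaPertH` makes Bałaban's UV stability UNCONDITIONAL — a real constructive-QFT
result; it is NOT the continuum limit and NOT the Clay problem.»  HONEST DEPENDENCY (verbatim): «continuum YM on T⁴ ⇐ BetaPertH ∧ nine spine estimates (0/9 proved);
BetaPertH ⇐ (D1) ∧ (D4) ∧ CAP+tail; G-an2-4 gates asym, D1 and NE2/3/4.»

## What
The (β) piece of the explicit first-order data `Ψ_j(y; ν, y′)` of `WardResidualSUnrolled.exists_kernelLaws_unrolled` is `vertexOfM G_j Lc (RM_j y) ν y′`, the mixed-law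
remainder `RM_j y` being DEFINED by an1's mixed table law (`hM₂` there).  Summed over the labels of a finset `T` (p2's `sum_remainder_of_tableLaw`):
`RM_T ρ′ w = cH • Σ_{x∈U} divV (M2 · · ρ′ w) x − [M1 ρ′ w, X_U]`, `U` the fine union of `T`, `X_U = diagK (½ • Σ_{u∈U} legInd ρ u)` — a FLUX letter plus a COMMUTATOR letter,
both anchored at the DILATED multiplier slot `N•w`.  THIS FILE, for ONE rate `0 < δ` and `Decays G CG δ`, `VertexFamily M1 N C1 δ`, `LocStencilFM N M2 C2 δ` (face weight
`FW_U^η(q)` written out as in PART 1, no `def`): §1 `biLoc_reanchor_third` (the `LocStencilFM` class read at the multiplier slot: rate ∕ coupling `δ∕3`), `faceW_le_card`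
(crude count, only for §3), `biLoc_smul_const`; §2 **`biLoc_fluxMinusComm`** (ANY finite `U`: `BiLoc (cH • Σ_{x∈U} divV (M2 · · ρ′ w) x − [M1 ρ′ w, X_U]) (N•w) (N•w)
((|cH|·C2 + ½·C1·e^{δ‖ρ‖₁})·FW_U^{δ∕3}(N•w)) (δ∕3)` — PART 1 (A)∕(B) at the anchor `N•w`), **`biLoc_sum_remainder`** (the label form, `RM` DISPLAYED by its law, `U` the
fine union of `T`); §3 `abs_sum_remainder_le ∕ abs_remainder_le` (uniform bounds for the exchange `vertexOfM_finset_sum`); §4 **`biLoc_sum_vertexOfM_remainder_of_faceW`**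
— THE LITERAL SHAPE: for any `W` with `FW_U^{δ∕3}(N•y′) ≤ W`, `BiLoc (Σ_{y∈T} vertexOfM G N (RM y) ν y′) (N•y′) (N•y′) ((d+1)·CG·(|cH|·C2 + ½·C1·e^{δ‖ρ‖₁})·Zl(δ∕6)·W) (δ∕6)`
(the `w`-dependence `FW(N•w) ≤ e^{(δ∕3)‖N•w−N•y′‖₁}·FW(N•y′)` of PART 1's `faceW_reanchor` is moved into the column weights by PART 2's `cwsum_smul_family`, where
`|colM G| ≤ CG·e^{−δ‖N•w−N•y′‖₁}` absorbs it; then `biLoc_cwsum`), face-sum form **`biLoc_sum_vertexOfM_remainder`**.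
= the (β) third of PART 5's `Ψ_T`.  DISCHARGES NO ROW: the literal `G_j ∕ M1_j ∕ M2_j ∕ RM_j`, `cH = (stepScale·Lc^{d+1})⁻¹` and their (level-free) classes enter only in
PART 6; (LAY)'s literal rows, (LT), K-LL-4, the (S) row, the END and (Q-R) are NOT here; 0 estimate of Bałaban's; NOTHING of (Q-R) ∕ (LT) ∕ (Q-L) ∕ (C) ∕ (S) ∕ «T2Shape» ∕
«T2Drift» ∕ (hW, hWall) discharged; NEVER «G-an2-4 closed» as (CONV-C); NOT D1, NOT `BetaPertH`, NOT continuum, NOT Clay.  2026-08-22.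
-/

noncomputable section

namespace Summit.QuantumFields.BalabanUV.Beta.GAN24.LayerLetterMixed

open Finset
open scoped BigOperators
open Literature.MathematicalPhysics.QuantumFieldTheory
open Literature.MathematicalPhysics.QuantumFieldTheory.Balaban1983to89
open Literature.MathematicalPhysics.QuantumFieldTheory.Balaban1983to89.Beta
open Literature.MathematicalPhysics.QuantumFieldTheory.Balaban1983to89.B12Sec2to5 (l1 l1_nonneg)
open B6BondElimination (unitVec)
open ExpKernelCalculus (MKer Site BiLoc Decays VertexFamily comp Zl Zl_nonneg l1_sub_triangle l1_sub_symm)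
open OneStepResolventKernel (Fib LocStencil wsum biLoc_finset_sum)
open SecondOrderResponse (colM vertexOfM LocStencilFM abs_colM_le)
open InterLevelTransport (cwsum cwsum_apply biLoc_cwsum)
open KernelWard (divV bdd_of_biLoc biLoc_add)
open StepJetData (biLoc_weaken)
open AffineAveraging (box toSite)
open Summit.QuantumFields.BalabanUV.Beta.BorderedHessian (diagK)
open Summit.QuantumFields.BalabanUV.Beta.AveragingWardRootedStencils (legSite legInd)
open Summit.QuantumFields.BalabanUV.Beta.GAN24.LayerFluxSupport (sub_apply4)
open Summit.QuantumFields.BalabanUV.Beta.GAN24.LayerLetterFaces (faceW_nonneg exp_le_faceW_of_mem faceW_mono_rate faceW_reanchor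
  biLoc_finsetSum_divV_anchor biLoc_comm_diagK_legInd_of_faceBound)
open Summit.QuantumFields.BalabanUV.Beta.GAN24.LayerLetterRotated (cwsum_smul_family)
open Summit.QuantumFields.BalabanUV.Beta.GAN24.WardResidualLabelSums (sum_remainder_of_tableLaw vertexOfM_finset_sum)
open Summit.QuantumFields.BalabanUV.Beta.GAN24.GaugeReadLayerForm (sum_sum_box_eq_sum_biUnion)

variable {d N : ℕ}

/-! ## §1 Re-anchoring to the dilated multiplier slot; a crude count of the face weight; scalar multiples -/

/-- [folklore] **RE-ANCHORING TO THE COUPLED POINT.**  A kernel bi-localised at `u` (rate `δ ≥ 0`) with a constant coupled to an anchor `q` like `C·e^{−δ‖u−q‖₁}` is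
bi-localised AT `q` with rate and coupling `δ∕3`: `BiLoc K q q (C·e^{−(δ∕3)‖u−q‖₁}) (δ∕3)` (two triangle inequalities; one third of the kernel decay is traded for the
move of the anchor).  The `LocStencilFM` class of a field–multiplier table read at its multiplier slot `N•w`. -/
theorem biLoc_reanchor_third {K : MKer (d + 1) (Fib d)} {C δ : ℝ} {u q : Site (d + 1)} (hδ : 0 ≤ δ) (hC : 0 ≤ C)
    (h : BiLoc K u u (C * Real.exp (-δ * l1 (u - q))) δ) :
    BiLoc K q q (C * Real.exp (-(δ / 3) * l1 (u - q))) (δ / 3) := by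
  intro x z a b
  have h1 := h x z a b
  have tx : l1 (x - q) ≤ l1 (x - u) + l1 (u - q) := l1_sub_triangle x u q
  have tz : l1 (z - q) ≤ l1 (z - u) + l1 (u - q) := l1_sub_triangle z u q
  have hexp : Real.exp (-δ * l1 (u - q)) * Real.exp (-δ * (l1 (x - u) + l1 (z - u)))
      ≤ Real.exp (-(δ / 3) * l1 (u - q)) * Real.exp (-(δ / 3) * (l1 (x - q) + l1 (z - q))) := by
    rw [← Real.exp_add, ← Real.exp_add, Real.exp_le_exp]
    nlinarith [l1_nonneg (u - q), l1_nonneg (x - u), l1_nonneg (z - u)]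
  calc |K x z a b| ≤ C * Real.exp (-δ * l1 (u - q)) * Real.exp (-δ * (l1 (x - u) + l1 (z - u))) := h1
    _ = C * (Real.exp (-δ * l1 (u - q)) * Real.exp (-δ * (l1 (x - u) + l1 (z - u)))) := by ring
    _ ≤ C * (Real.exp (-(δ / 3) * l1 (u - q)) * Real.exp (-(δ / 3) * (l1 (x - q) + l1 (z - q)))) := mul_le_mul_of_nonneg_left hexp hC
    _ = _ := by ring

/-- [folklore] A CRUDE COUNT (used only for uniform boundedness, never as the estimate): `FW_U^η(q) ≤ 2(d+1)·|U|` for `0 ≤ η` (each inner face lies in `U`, each outer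
face in a translate of `U`, each exponential is `≤ 1`). -/
theorem faceW_le_card (U : Finset (Site (d + 1))) {η : ℝ} (hη : 0 ≤ η) (q : Site (d + 1)) :
    (∑ ν : Fin (d + 1),
      (∑ w' ∈ U.image (fun v => v - unitVec ν) \ U, Real.exp (-η * l1 (w' - q))
        + ∑ w' ∈ U \ U.image (fun v => v - unitVec ν), Real.exp (-η * l1 (w' - q)))) ≤ 2 * ((d : ℝ) + 1) * U.card := by
  have hone : ∀ w' : Site (d + 1), Real.exp (-η * l1 (w' - q)) ≤ 1 := fun w' => by
    rw [Real.exp_le_one_iff]; nlinarith [l1_nonneg (w' - q)]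
  have hface : ∀ ν : Fin (d + 1),
      (∑ w' ∈ U.image (fun v => v - unitVec ν) \ U, Real.exp (-η * l1 (w' - q))
        + ∑ w' ∈ U \ U.image (fun v => v - unitVec ν), Real.exp (-η * l1 (w' - q))) ≤ 2 * (U.card : ℝ) := by
    intro ν
    have h1 : ∑ w' ∈ U.image (fun v => v - unitVec ν) \ U, Real.exp (-η * l1 (w' - q)) ≤ (U.card : ℝ) := by
      refine (Finset.sum_le_sum fun w' _ => hone w').trans ?_
      rw [Finset.sum_const, nsmul_eq_mul, mul_one]
      exact_mod_cast (Finset.card_le_card Finset.sdiff_subset).trans Finset.card_image_le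
    have h2 : ∑ w' ∈ U \ U.image (fun v => v - unitVec ν), Real.exp (-η * l1 (w' - q)) ≤ (U.card : ℝ) := by
      refine (Finset.sum_le_sum fun w' _ => hone w').trans ?_
      rw [Finset.sum_const, nsmul_eq_mul, mul_one]
      exact_mod_cast Finset.card_le_card Finset.sdiff_subset
    linarith
  calc (∑ ν : Fin (d + 1),
      (∑ w' ∈ U.image (fun v => v - unitVec ν) \ U, Real.exp (-η * l1 (w' - q))
        + ∑ w' ∈ U \ U.image (fun v => v - unitVec ν), Real.exp (-η * l1 (w' - q))))
      ≤ ∑ _ν : Fin (d + 1), 2 * (U.card : ℝ) := Finset.sum_le_sum fun ν _ => hface ν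
    _ = 2 * ((d : ℝ) + 1) * U.card := by
        rw [Finset.sum_const, Finset.card_univ, Fintype.card_fin, nsmul_eq_mul]; push_cast; ring

/-- [folklore] A nonnegative scalar multiple of a bi-localised kernel. -/
theorem biLoc_smul_const {K : MKer (d + 1) (Fib d)} {p q : Site (d + 1)} {C δ c : ℝ} (h : BiLoc K p q C δ) (hc : 0 ≤ c) :
    BiLoc (c • K) p q (c * C) δ := by
  intro x z a b
  rw [Pi.smul_apply, Pi.smul_apply, Pi.smul_apply, Pi.smul_apply, smul_eq_mul, abs_mul, abs_of_nonneg hc, mul_assoc]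
  exact mul_le_mul_of_nonneg_left (h x z a b) hc

/-- [folklore] The constant of a `LocStencilFM` class is nonnegative. -/
theorem nonneg_of_locStencilFM {M2 : Fin (d + 1) → Site (d + 1) → Fin (d + 1) → Site (d + 1) → MKer (d + 1) (Fib d)} {C2 δ : ℝ}
    (hM2 : LocStencilFM N M2 C2 δ) : 0 ≤ C2 := by
  have h := (hM2 0 0 0 0).nonneg (Sum.inl 0)
  have he : 0 < Real.exp (-δ * l1 ((0 : Site (d + 1)) - (N : ℤ) • (0 : Site (d + 1)))) := Real.exp_pos _
  nlinarith

/-! ## §2 «Flux over `U` minus the commutator with `X_U`» at the multiplier slot -/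

/-- [folklore] **«FLUX MINUS COMMUTATOR» IS A FACE LETTER AT THE MULTIPLIER SLOT.**  `VertexFamily M1 N C1 δ`, `LocStencilFM N M2 C2 δ` (`0 < δ`), ANY finite `U`:
`BiLoc (cH • Σ_{x∈U} divV (M2 · · ρ′ w) x − [M1 ρ′ w, X_U]) (N•w) (N•w) ((|cH|·C2 + ½·C1·e^{δ‖ρ‖₁})·FW_U^{δ∕3}(N•w)) (δ∕3)`, `X_U = diagK (½ • Σ_{u∈U} legInd ρ u)` — flux: PART 1 (A)
at the anchor `N•w` after `biLoc_reanchor_third`; commutator: PART 1 (B) at `N•w` with `W := FW^{δ∕3}(N•w)` (dominates `e^{−(δ∕2)‖f−N•w‖₁}` on the layer), rate weakened to `δ∕3`. -/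
theorem biLoc_fluxMinusComm
    {M1 : Fin (d + 1) → Site (d + 1) → MKer (d + 1) (Fib d)} {C1 δ : ℝ} (hM1 : VertexFamily M1 N C1 δ) (hδ : 0 < δ)
    {M2 : Fin (d + 1) → Site (d + 1) → Fin (d + 1) → Site (d + 1) → MKer (d + 1) (Fib d)} {C2 : ℝ} (hM2 : LocStencilFM N M2 C2 δ)
    (U : Finset (Site (d + 1))) (ρ : Site (d + 1)) (cH : ℝ) (ρ' : Fin (d + 1)) (w : Site (d + 1)) :
    BiLoc (cH • ∑ x ∈ U, divV (fun κ u => M2 κ u ρ' w) x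
        - (comp (M1 ρ' w) (diagK (((1 : ℝ) / 2) • ∑ u ∈ U, legInd ρ u)) - comp (diagK (((1 : ℝ) / 2) • ∑ u ∈ U, legInd ρ u)) (M1 ρ' w)))
      ((N : ℤ) • w) ((N : ℤ) • w)
      ((|cH| * C2 + (1 / 2 : ℝ) * C1 * Real.exp (δ * l1 ρ))
        * ∑ ν : Fin (d + 1),
          (∑ w' ∈ U.image (fun v => v - unitVec ν) \ U, Real.exp (-(δ / 3) * l1 (w' - (N : ℤ) • w))
            + ∑ w' ∈ U \ U.image (fun v => v - unitVec ν), Real.exp (-(δ / 3) * l1 (w' - (N : ℤ) • w)))) (δ / 3) := by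
  have hC1 : 0 ≤ C1 := (hM1 0 0).nonneg (Sum.inl 0)
  have hC2 : 0 ≤ C2 := nonneg_of_locStencilFM hM2
  have hFW0 := faceW_nonneg U (δ / 3) ((N : ℤ) • w)
  -- (A) the flux letter at the anchor `N•w`
  have hF : ∀ μ x', BiLoc (M2 μ x' ρ' w) ((N : ℤ) • w) ((N : ℤ) • w) (C2 * Real.exp (-(δ / 3) * l1 (x' - (N : ℤ) • w))) (δ / 3) := fun μ x' =>
    biLoc_reanchor_third hδ.le hC2 (hM2 μ x' ρ' w)
  have hA := biLoc_finsetSum_divV_anchor hF U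
  -- (B) the commutator letter at the anchor `N•w`, weight `FW^{δ/3}` (dominates the layer exponentials at rate `δ/2`)
  have hWdom : ∀ μ f, (f ∈ U \ U.image (fun v => v - unitVec μ) ∨ f ∈ U.image (fun v => v - unitVec μ) \ U) →
      Real.exp (-(δ / 2) * l1 (f - (N : ℤ) • w)) ≤ ∑ ν : Fin (d + 1),
          (∑ w' ∈ U.image (fun v => v - unitVec ν) \ U, Real.exp (-(δ / 3) * l1 (w' - (N : ℤ) • w))
            + ∑ w' ∈ U \ U.image (fun v => v - unitVec ν), Real.exp (-(δ / 3) * l1 (w' - (N : ℤ) • w))) := by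
    intro μ f hf
    have h1 : Real.exp (-(δ / 2) * l1 (f - (N : ℤ) • w)) ≤ Real.exp (-(δ / 3) * l1 (f - (N : ℤ) • w)) := by
      rw [Real.exp_le_exp]; nlinarith [l1_nonneg (f - (N : ℤ) • w)]
    exact h1.trans (exp_le_faceW_of_mem U (δ / 3) _ hf)
  have hB := biLoc_comm_diagK_legInd_of_faceBound (hM1 ρ' w) hδ.le U ρ ((1 : ℝ) / 2) hFW0 hWdom
  have hB' := biLoc_weaken hB le_rfl (show δ / 3 ≤ δ / 2 by linarith)
  -- assemble: `cH • flux − comm`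
  intro x z a b
  rw [sub_apply4, Pi.smul_apply, Pi.smul_apply, Pi.smul_apply, Pi.smul_apply, smul_eq_mul]
  have h1 := hA x z a b
  have h2 := hB' x z a b
  have habs : |(1 : ℝ) / 2| = 1 / 2 := abs_of_pos (by norm_num)
  rw [habs] at h2
  calc |cH * (∑ x' ∈ U, divV (fun κ u => M2 κ u ρ' w) x') x z a b
        - (comp (M1 ρ' w) (diagK (((1 : ℝ) / 2) • ∑ u ∈ U, legInd ρ u))
            - comp (diagK (((1 : ℝ) / 2) • ∑ u ∈ U, legInd ρ u)) (M1 ρ' w)) x z a b|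
      ≤ |cH| * |(∑ x' ∈ U, divV (fun κ u => M2 κ u ρ' w) x') x z a b|
        + |(comp (M1 ρ' w) (diagK (((1 : ℝ) / 2) • ∑ u ∈ U, legInd ρ u))
            - comp (diagK (((1 : ℝ) / 2) • ∑ u ∈ U, legInd ρ u)) (M1 ρ' w)) x z a b| := by
        rw [← abs_mul]; exact abs_sub _ _
    _ ≤ |cH| * (C2 * (∑ ν : Fin (d + 1),
          (∑ w' ∈ U.image (fun v => v - unitVec ν) \ U, Real.exp (-(δ / 3) * l1 (w' - (N : ℤ) • w))
            + ∑ w' ∈ U \ U.image (fun v => v - unitVec ν), Real.exp (-(δ / 3) * l1 (w' - (N : ℤ) • w))))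
          * Real.exp (-(δ / 3) * (l1 (x - (N : ℤ) • w) + l1 (z - (N : ℤ) • w))))
        + (1 / 2 * C1 * Real.exp (δ * l1 ρ) * (∑ ν : Fin (d + 1),
          (∑ w' ∈ U.image (fun v => v - unitVec ν) \ U, Real.exp (-(δ / 3) * l1 (w' - (N : ℤ) • w))
            + ∑ w' ∈ U \ U.image (fun v => v - unitVec ν), Real.exp (-(δ / 3) * l1 (w' - (N : ℤ) • w))))
          * Real.exp (-(δ / 3) * (l1 (x - (N : ℤ) • w) + l1 (z - (N : ℤ) • w)))) :=
        add_le_add (mul_le_mul_of_nonneg_left h1 (abs_nonneg _)) h2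
    _ = _ := by ring

/-- [folklore] **THE SUMMED MIXED REMAINDER IS A FACE LETTER AT THE MULTIPLIER SLOT.**  `RM y` given by the displayed table law `hlaw` (an1's mixed law `hM₂` of
`WardResidualSUnrolled.exists_kernelLaws_unrolled`, `cH = (scale)⁻¹`, `X_y = diagK (½ • Σ_{v∈box} legInd ρ (N•y + toSite v))`); for every finset `T` (fine union `U`) and slot `(ρ′, w)`:
`BiLoc (Σ_{y∈T} RM y ρ′ w) (N•w) (N•w) ((|cH|·C2 + ½·C1·e^{δ‖ρ‖₁})·FW_U^{δ∕3}(N•w)) (δ∕3)` (`sum_remainder_of_tableLaw` ⨾ `sum_sum_box_eq_sum_biUnion` twice ⨾ `biLoc_fluxMinusComm`). -/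
theorem biLoc_sum_remainder
    {M1 : Fin (d + 1) → Site (d + 1) → MKer (d + 1) (Fib d)} {C1 δ : ℝ} (hM1 : VertexFamily M1 N C1 δ) (hδ : 0 < δ)
    {M2 : Fin (d + 1) → Site (d + 1) → Fin (d + 1) → Site (d + 1) → MKer (d + 1) (Fib d)} {C2 : ℝ} (hM2 : LocStencilFM N M2 C2 δ)
    {RM : Site (d + 1) → Fin (d + 1) → Site (d + 1) → MKer (d + 1) (Fib d)} {cH : ℝ} {ρ : Site (d + 1)}
    (hlaw : ∀ (y : Site (d + 1)) (ρ' : Fin (d + 1)) (w : Site (d + 1)),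
      cH • ∑ v ∈ box (d + 1) N, divV (fun κ u => M2 κ u ρ' w) ((N : ℤ) • y + toSite v) =
        comp (M1 ρ' w) (diagK (((1 : ℝ) / 2) • ∑ v ∈ box (d + 1) N, legInd ρ ((N : ℤ) • y + toSite v)))
          - comp (diagK (((1 : ℝ) / 2) • ∑ v ∈ box (d + 1) N, legInd ρ ((N : ℤ) • y + toSite v))) (M1 ρ' w) + RM y ρ' w)
    (T : Finset (Site (d + 1))) (ρ' : Fin (d + 1)) (w : Site (d + 1)) :
    BiLoc (∑ y ∈ T, RM y ρ' w) ((N : ℤ) • w) ((N : ℤ) • w)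
      ((|cH| * C2 + (1 / 2 : ℝ) * C1 * Real.exp (δ * l1 ρ))
        * ∑ ν : Fin (d + 1),
          (∑ w' ∈ (T.biUnion (fun y => (box (d + 1) N).image (fun v => (N : ℤ) • y + toSite v))).image (fun v => v - unitVec ν)
                \ T.biUnion (fun y => (box (d + 1) N).image (fun v => (N : ℤ) • y + toSite v)), Real.exp (-(δ / 3) * l1 (w' - (N : ℤ) • w))
            + ∑ w' ∈ T.biUnion (fun y => (box (d + 1) N).image (fun v => (N : ℤ) • y + toSite v))
                \ (T.biUnion (fun y => (box (d + 1) N).image (fun v => (N : ℤ) • y + toSite v))).image (fun v => v - unitVec ν),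
                  Real.exp (-(δ / 3) * l1 (w' - (N : ℤ) • w)))) (δ / 3) := by
  have hsum := sum_remainder_of_tableLaw (lab := id) (S₂ := M2) (S := fun ρ' w => M1 ρ' w)
    (g := fun y => ((1 : ℝ) / 2) • ∑ v ∈ box (d + 1) N, legInd ρ ((N : ℤ) • y + toSite v)) (R := RM) (cH := cH)
    (fun y κ' u' => hlaw y κ' u') T ρ' w
  have hflux : ∑ y ∈ T, ∑ v ∈ box (d + 1) N, divV (fun κ u => M2 κ u ρ' w) ((N : ℤ) • id y + toSite v)
      = ∑ x ∈ T.biUnion (fun y => (box (d + 1) N).image (fun v => (N : ℤ) • y + toSite v)), divV (fun κ u => M2 κ u ρ' w) x :=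
    sum_sum_box_eq_sum_biUnion (N := N) T (fun x => divV (fun κ u => M2 κ u ρ' w) x)
  have hgen : ∑ y ∈ T, ((1 : ℝ) / 2) • ∑ v ∈ box (d + 1) N, legInd ρ ((N : ℤ) • y + toSite v)
      = ((1 : ℝ) / 2) • ∑ u ∈ T.biUnion (fun y => (box (d + 1) N).image (fun v => (N : ℤ) • y + toSite v)), legInd ρ u := by
    rw [← Finset.smul_sum, sum_sum_box_eq_sum_biUnion (N := N) T (legInd ρ)]
  rw [hflux, hgen] at hsum
  rw [hsum]
  exact biLoc_fluxMinusComm hM1 hδ hM2 _ ρ cH ρ' w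

/-! ## §3 Uniform boundedness of the summed remainders (for the exchange `vertexOfM_finset_sum`) -/

/-- [folklore] The summed remainder is uniformly bounded: `|Σ_{y∈T} RM y ρ′ w x z a b| ≤ (|cH|·C2 + ½·C1·e^{δ‖ρ‖₁})·2(d+1)·|U|` (§2 with the crude count `faceW_le_card`). -/
theorem abs_sum_remainder_le
    {M1 : Fin (d + 1) → Site (d + 1) → MKer (d + 1) (Fib d)} {C1 δ : ℝ} (hM1 : VertexFamily M1 N C1 δ) (hδ : 0 < δ)
    {M2 : Fin (d + 1) → Site (d + 1) → Fin (d + 1) → Site (d + 1) → MKer (d + 1) (Fib d)} {C2 : ℝ} (hM2 : LocStencilFM N M2 C2 δ)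
    {RM : Site (d + 1) → Fin (d + 1) → Site (d + 1) → MKer (d + 1) (Fib d)} {cH : ℝ} {ρ : Site (d + 1)}
    (hlaw : ∀ (y : Site (d + 1)) (ρ' : Fin (d + 1)) (w : Site (d + 1)),
      cH • ∑ v ∈ box (d + 1) N, divV (fun κ u => M2 κ u ρ' w) ((N : ℤ) • y + toSite v) =
        comp (M1 ρ' w) (diagK (((1 : ℝ) / 2) • ∑ v ∈ box (d + 1) N, legInd ρ ((N : ℤ) • y + toSite v)))
          - comp (diagK (((1 : ℝ) / 2) • ∑ v ∈ box (d + 1) N, legInd ρ ((N : ℤ) • y + toSite v))) (M1 ρ' w) + RM y ρ' w)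
    (T : Finset (Site (d + 1))) (ρ' : Fin (d + 1)) (w x z : Site (d + 1)) (a b : Fib d) :
    |(∑ y ∈ T, RM y ρ' w) x z a b| ≤ (|cH| * C2 + (1 / 2 : ℝ) * C1 * Real.exp (δ * l1 ρ))
      * (2 * ((d : ℝ) + 1) * (T.biUnion (fun y => (box (d + 1) N).image (fun v => (N : ℤ) • y + toSite v))).card) := by
  have hC1 : 0 ≤ C1 := (hM1 0 0).nonneg (Sum.inl 0)
  have hC2 : 0 ≤ C2 := nonneg_of_locStencilFM hM2
  have hK : 0 ≤ |cH| * C2 + (1 / 2 : ℝ) * C1 * Real.exp (δ * l1 ρ) := by positivity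
  have h := biLoc_sum_remainder hM1 hδ hM2 hlaw T ρ' w x z a b
  have hcard := faceW_le_card (T.biUnion (fun y => (box (d + 1) N).image (fun v => (N : ℤ) • y + toSite v)))
    (show (0 : ℝ) ≤ δ / 3 by linarith) ((N : ℤ) • w)
  have hexp : Real.exp (-(δ / 3) * (l1 (x - (N : ℤ) • w) + l1 (z - (N : ℤ) • w))) ≤ 1 := by
    rw [Real.exp_le_one_iff]; nlinarith [l1_nonneg (x - (N : ℤ) • w), l1_nonneg (z - (N : ℤ) • w)]
  refine h.trans ?_
  calc (|cH| * C2 + (1 / 2 : ℝ) * C1 * Real.exp (δ * l1 ρ))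
        * (∑ ν : Fin (d + 1),
          (∑ w' ∈ (T.biUnion (fun y => (box (d + 1) N).image (fun v => (N : ℤ) • y + toSite v))).image (fun v => v - unitVec ν)
                \ T.biUnion (fun y => (box (d + 1) N).image (fun v => (N : ℤ) • y + toSite v)), Real.exp (-(δ / 3) * l1 (w' - (N : ℤ) • w))
            + ∑ w' ∈ T.biUnion (fun y => (box (d + 1) N).image (fun v => (N : ℤ) • y + toSite v))
                \ (T.biUnion (fun y => (box (d + 1) N).image (fun v => (N : ℤ) • y + toSite v))).image (fun v => v - unitVec ν),
                  Real.exp (-(δ / 3) * l1 (w' - (N : ℤ) • w))))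
        * Real.exp (-(δ / 3) * (l1 (x - (N : ℤ) • w) + l1 (z - (N : ℤ) • w)))
      ≤ (|cH| * C2 + (1 / 2 : ℝ) * C1 * Real.exp (δ * l1 ρ))
        * (2 * ((d : ℝ) + 1) * (T.biUnion (fun y => (box (d + 1) N).image (fun v => (N : ℤ) • y + toSite v))).card) * 1 :=
        mul_le_mul (mul_le_mul_of_nonneg_left hcard hK) hexp (Real.exp_pos _).le (by positivity)
    _ = _ := by ring

/-- [folklore] One label: `|RM y ρ′ w x z a b| ≤ (|cH|·C2 + ½·C1·e^{δ‖ρ‖₁})·2(d+1)·|box|` (`T = {y}`; the fine union of one label is one block). -/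
theorem abs_remainder_le
    {M1 : Fin (d + 1) → Site (d + 1) → MKer (d + 1) (Fib d)} {C1 δ : ℝ} (hM1 : VertexFamily M1 N C1 δ) (hδ : 0 < δ)
    {M2 : Fin (d + 1) → Site (d + 1) → Fin (d + 1) → Site (d + 1) → MKer (d + 1) (Fib d)} {C2 : ℝ} (hM2 : LocStencilFM N M2 C2 δ)
    {RM : Site (d + 1) → Fin (d + 1) → Site (d + 1) → MKer (d + 1) (Fib d)} {cH : ℝ} {ρ : Site (d + 1)}
    (hlaw : ∀ (y : Site (d + 1)) (ρ' : Fin (d + 1)) (w : Site (d + 1)),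
      cH • ∑ v ∈ box (d + 1) N, divV (fun κ u => M2 κ u ρ' w) ((N : ℤ) • y + toSite v) =
        comp (M1 ρ' w) (diagK (((1 : ℝ) / 2) • ∑ v ∈ box (d + 1) N, legInd ρ ((N : ℤ) • y + toSite v)))
          - comp (diagK (((1 : ℝ) / 2) • ∑ v ∈ box (d + 1) N, legInd ρ ((N : ℤ) • y + toSite v))) (M1 ρ' w) + RM y ρ' w)
    (y : Site (d + 1)) (ρ' : Fin (d + 1)) (w x z : Site (d + 1)) (a b : Fib d) :
    |RM y ρ' w x z a b| ≤ (|cH| * C2 + (1 / 2 : ℝ) * C1 * Real.exp (δ * l1 ρ)) * (2 * ((d : ℝ) + 1) * (box (d + 1) N).card) := by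
  have hC1 : 0 ≤ C1 := (hM1 0 0).nonneg (Sum.inl 0)
  have hC2 : 0 ≤ C2 := nonneg_of_locStencilFM hM2
  have hK : 0 ≤ |cH| * C2 + (1 / 2 : ℝ) * C1 * Real.exp (δ * l1 ρ) := by positivity
  have h := abs_sum_remainder_le hM1 hδ hM2 hlaw {y} ρ' w x z a b
  rw [Finset.sum_singleton] at h
  refine h.trans (mul_le_mul_of_nonneg_left (mul_le_mul_of_nonneg_left ?_ (by positivity)) hK)
  rw [Finset.singleton_biUnion]
  exact_mod_cast Finset.card_image_le

/-! ## §4 The (β) piece summed over labels: the multiplier-column vertex of the summed remainder -/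

/-- [folklore] **THE MIXED-REMAINDER PIECE (β) SUMMED OVER THE LABELS OF A SUPER-BLOCK IS A FACE LETTER AT THE SLOT (face-sum domination form).**
`Decays G CG δ`, `VertexFamily M1 N C1 δ`, `LocStencilFM N M2 C2 δ` (`0 < δ`, `N ≥ 1`), `RM` by its displayed law, `T` with fine union `U`, slot `(ν, y′)`, any `W ≥ FW_U^{δ∕3}(N•y′)`:
`BiLoc (Σ_{y∈T} vertexOfM G N (RM y) ν y′) (N•y′) (N•y′) ((d+1)·CG·(|cH|·C2 + ½·C1·e^{δ‖ρ‖₁})·Zl(δ∕6)·W) (δ∕6)` — `vertexOfM_finset_sum` (§3) ⨾ per `ρ′` the coarse superposition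
`cwsum N (colM G N ν y′ ρ′) (RM_T ρ′)` ⨾ §2 at `N•w` ⨾ `faceW_reanchor` (`FW(N•w) ≤ e^{(δ∕3)‖N•w−N•y′‖₁}·FW(N•y′)`, the exponential moved into the column weights by
`cwsum_smul_family` and absorbed by `|colM G| ≤ CG·e^{−δ‖N•w−N•y′‖₁}`) ⨾ `biLoc_cwsum` at rate `δ∕3`. -/
theorem biLoc_sum_vertexOfM_remainder_of_faceW [NeZero N] {G : MKer (d + 1) (Fib d)} {CG δ : ℝ} (hG : Decays G CG δ) (hδ : 0 < δ)
    {M1 : Fin (d + 1) → Site (d + 1) → MKer (d + 1) (Fib d)} {C1 : ℝ} (hM1 : VertexFamily M1 N C1 δ)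
    {M2 : Fin (d + 1) → Site (d + 1) → Fin (d + 1) → Site (d + 1) → MKer (d + 1) (Fib d)} {C2 : ℝ} (hM2 : LocStencilFM N M2 C2 δ)
    {RM : Site (d + 1) → Fin (d + 1) → Site (d + 1) → MKer (d + 1) (Fib d)} {cH : ℝ} {ρ : Site (d + 1)}
    (hlaw : ∀ (y : Site (d + 1)) (ρ' : Fin (d + 1)) (w : Site (d + 1)),
      cH • ∑ v ∈ box (d + 1) N, divV (fun κ u => M2 κ u ρ' w) ((N : ℤ) • y + toSite v) =
        comp (M1 ρ' w) (diagK (((1 : ℝ) / 2) • ∑ v ∈ box (d + 1) N, legInd ρ ((N : ℤ) • y + toSite v)))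
          - comp (diagK (((1 : ℝ) / 2) • ∑ v ∈ box (d + 1) N, legInd ρ ((N : ℤ) • y + toSite v))) (M1 ρ' w) + RM y ρ' w)
    (T : Finset (Site (d + 1))) (ν : Fin (d + 1)) (y' : Site (d + 1)) {W : ℝ}
    (hW : (∑ μ : Fin (d + 1),
          (∑ w' ∈ (T.biUnion (fun y => (box (d + 1) N).image (fun v => (N : ℤ) • y + toSite v))).image (fun v => v - unitVec μ)
                \ T.biUnion (fun y => (box (d + 1) N).image (fun v => (N : ℤ) • y + toSite v)), Real.exp (-(δ / 3) * l1 (w' - (N : ℤ) • y'))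
            + ∑ w' ∈ T.biUnion (fun y => (box (d + 1) N).image (fun v => (N : ℤ) • y + toSite v))
                \ (T.biUnion (fun y => (box (d + 1) N).image (fun v => (N : ℤ) • y + toSite v))).image (fun v => v - unitVec μ),
                  Real.exp (-(δ / 3) * l1 (w' - (N : ℤ) • y')))) ≤ W) :
    BiLoc (∑ y ∈ T, vertexOfM G N (RM y) ν y') ((N : ℤ) • y') ((N : ℤ) • y')
      (((d : ℝ) + 1) * CG * (|cH| * C2 + (1 / 2 : ℝ) * C1 * Real.exp (δ * l1 ρ)) * Zl (d + 1) (δ / 6) * W) (δ / 6) := by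
  have hC1 : 0 ≤ C1 := (hM1 0 0).nonneg (Sum.inl 0)
  have hC2 : 0 ≤ C2 := nonneg_of_locStencilFM hM2
  have hCG : 0 ≤ CG := hG.nonneg (Sum.inl 0)
  have hK : 0 ≤ |cH| * C2 + (1 / 2 : ℝ) * C1 * Real.exp (δ * l1 ρ) := by positivity
  have hW0 : 0 ≤ W := (faceW_nonneg _ (δ / 3) _).trans hW
  -- exchange the label sum with the vertex
  have hG' : ∃ δ' C' : ℝ, 0 < δ' ∧ 0 ≤ C' ∧ Decays G C' δ' := ⟨δ, CG, hδ, hCG, hG⟩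
  have hB := abs_remainder_le hM1 hδ hM2 hlaw
  rw [← vertexOfM_finset_sum hG' N (fun y ρ' w x z a b => hB y ρ' w x z a b) T ν y']
  -- the vertex as a finite sum of coarse superpositions
  have e : vertexOfM G N (fun ρ' w => ∑ y ∈ T, RM y ρ' w) ν y'
      = fun x z a b => ∑ ρ' : Fin (d + 1), cwsum N (colM G N ν y' ρ') (fun w => ∑ y ∈ T, RM y ρ' w) x z a b := by
    funext x z a b; simp only [SecondOrderResponse.vertexOfM]
  rw [e]
  set q : Site (d + 1) := (N : ℤ) • y' with hq
  -- per direction `ρ′`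
  have hρ' : ∀ ρ' : Fin (d + 1), BiLoc (cwsum N (colM G N ν y' ρ') (fun w => ∑ y ∈ T, RM y ρ' w)) q q
      (CG * ((|cH| * C2 + (1 / 2 : ℝ) * C1 * Real.exp (δ * l1 ρ)) * W) * Zl (d + 1) (δ / 6)) (δ / 6) := by
    intro ρ'
    -- move `e^{(δ/3)‖N•w − q‖}` into the weights
    have hsplit : cwsum N (colM G N ν y' ρ') (fun w => ∑ y ∈ T, RM y ρ' w)
        = cwsum N (fun w => colM G N ν y' ρ' w * Real.exp ((δ / 3) * l1 ((N : ℤ) • w - q)))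
            (fun w => Real.exp (-(δ / 3) * l1 ((N : ℤ) • w - q)) • ∑ y ∈ T, RM y ρ' w) := by
      rw [cwsum_smul_family]
      congr 1
      funext w
      rw [mul_assoc, ← Real.exp_add, show (δ / 3) * l1 ((N : ℤ) • w - q) + -(δ / 3) * l1 ((N : ℤ) • w - q) = 0 by ring, Real.exp_zero, mul_one]
    rw [hsplit]
    have hw : ∀ w, |colM G N ν y' ρ' w * Real.exp ((δ / 3) * l1 ((N : ℤ) • w - q))| ≤ CG * Real.exp (-(δ / 3) * l1 ((N : ℤ) • w - q)) := by
      intro w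
      have h1 : |colM G N ν y' ρ' w| ≤ CG * Real.exp (-δ * l1 ((N : ℤ) • w - q)) := abs_colM_le hG ν y' ρ' w
      rw [abs_mul, abs_of_pos (Real.exp_pos _)]
      calc |colM G N ν y' ρ' w| * Real.exp ((δ / 3) * l1 ((N : ℤ) • w - q))
          ≤ CG * Real.exp (-δ * l1 ((N : ℤ) • w - q)) * Real.exp ((δ / 3) * l1 ((N : ℤ) • w - q)) :=
            mul_le_mul_of_nonneg_right h1 (Real.exp_pos _).le
        _ = CG * Real.exp (-(2 * δ / 3) * l1 ((N : ℤ) • w - q)) := by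
            rw [mul_assoc, ← Real.exp_add]; congr 2; ring
        _ ≤ CG * Real.exp (-(δ / 3) * l1 ((N : ℤ) • w - q)) := by
            refine mul_le_mul_of_nonneg_left ?_ hCG
            rw [Real.exp_le_exp]; nlinarith [l1_nonneg ((N : ℤ) • w - q)]
    have hQ : ∀ w, BiLoc (Real.exp (-(δ / 3) * l1 ((N : ℤ) • w - q)) • ∑ y ∈ T, RM y ρ' w) ((N : ℤ) • w) ((N : ℤ) • w)
        ((|cH| * C2 + (1 / 2 : ℝ) * C1 * Real.exp (δ * l1 ρ)) * W) (δ / 3) := by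
      intro w
      have h1 := biLoc_sum_remainder hM1 hδ hM2 hlaw T ρ' w
      have h2 := biLoc_smul_const h1 (Real.exp_pos (-(δ / 3) * l1 ((N : ℤ) • w - q))).le
      refine biLoc_weaken h2 ?_ le_rfl
      have hre := faceW_reanchor (T.biUnion (fun y => (box (d + 1) N).image (fun v => (N : ℤ) • y + toSite v)))
        (show (0 : ℝ) ≤ δ / 3 by linarith) ((N : ℤ) • w) q
      have hexp0 : 0 ≤ Real.exp (-(δ / 3) * l1 ((N : ℤ) • w - q)) := (Real.exp_pos _).le
      calc Real.exp (-(δ / 3) * l1 ((N : ℤ) • w - q)) * ((|cH| * C2 + (1 / 2 : ℝ) * C1 * Real.exp (δ * l1 ρ))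
            * ∑ ν : Fin (d + 1),
              (∑ w' ∈ (T.biUnion (fun y => (box (d + 1) N).image (fun v => (N : ℤ) • y + toSite v))).image (fun v => v - unitVec ν)
                    \ T.biUnion (fun y => (box (d + 1) N).image (fun v => (N : ℤ) • y + toSite v)), Real.exp (-(δ / 3) * l1 (w' - (N : ℤ) • w))
                + ∑ w' ∈ T.biUnion (fun y => (box (d + 1) N).image (fun v => (N : ℤ) • y + toSite v))
                    \ (T.biUnion (fun y => (box (d + 1) N).image (fun v => (N : ℤ) • y + toSite v))).image (fun v => v - unitVec ν),
                      Real.exp (-(δ / 3) * l1 (w' - (N : ℤ) • w))))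
          ≤ Real.exp (-(δ / 3) * l1 ((N : ℤ) • w - q)) * ((|cH| * C2 + (1 / 2 : ℝ) * C1 * Real.exp (δ * l1 ρ))
            * (Real.exp ((δ / 3) * l1 ((N : ℤ) • w - q)) * W)) := by
            refine mul_le_mul_of_nonneg_left (mul_le_mul_of_nonneg_left (hre.trans ?_) hK) hexp0
            exact mul_le_mul_of_nonneg_left hW (Real.exp_pos _).le
        _ = (|cH| * C2 + (1 / 2 : ℝ) * C1 * Real.exp (δ * l1 ρ)) * W := by
            have e1 : Real.exp (-(δ / 3) * l1 ((N : ℤ) • w - q)) * Real.exp ((δ / 3) * l1 ((N : ℤ) • w - q)) = 1 := by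
              rw [← Real.exp_add, show -(δ / 3) * l1 ((N : ℤ) • w - q) + (δ / 3) * l1 ((N : ℤ) • w - q) = 0 by ring, Real.exp_zero]
            calc Real.exp (-(δ / 3) * l1 ((N : ℤ) • w - q)) * ((|cH| * C2 + (1 / 2 : ℝ) * C1 * Real.exp (δ * l1 ρ))
                  * (Real.exp ((δ / 3) * l1 ((N : ℤ) • w - q)) * W))
                = (Real.exp (-(δ / 3) * l1 ((N : ℤ) • w - q)) * Real.exp ((δ / 3) * l1 ((N : ℤ) • w - q)))
                  * ((|cH| * C2 + (1 / 2 : ℝ) * C1 * Real.exp (δ * l1 ρ)) * W) := by ring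
              _ = _ := by rw [e1, one_mul]
    have h := biLoc_cwsum hw hQ (show 0 < δ / 3 by linarith) hCG
    rw [show δ / 3 / 2 = δ / 6 by ring] at h
    exact h
  have hsum := biLoc_finset_sum (Finset.univ : Finset (Fin (d + 1))) (fun ρ' _ => hρ' ρ')
  rw [Finset.sum_const, Finset.card_univ, Fintype.card_fin, nsmul_eq_mul] at hsum
  exact biLoc_weaken hsum (le_of_eq (by push_cast; ring)) le_rfl

/-- [folklore] **THE MIXED-REMAINDER PIECE (β) SUMMED OVER THE LABELS OF A SUPER-BLOCK, FACE-SUM FORM** (`W := FW_U^{δ∕3}(N•y′)`): constant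
`(d+1)·CG·(|cH|·C2 + ½·C1·e^{δ‖ρ‖₁})·Zl(δ∕6)·FW_U^{δ∕3}(N•y′)`, rate `δ∕6` — supported near the boundary layer of the fine union, UNIFORMLY IN `T` except through the face weight. -/
theorem biLoc_sum_vertexOfM_remainder [NeZero N] {G : MKer (d + 1) (Fib d)} {CG δ : ℝ} (hG : Decays G CG δ) (hδ : 0 < δ)
    {M1 : Fin (d + 1) → Site (d + 1) → MKer (d + 1) (Fib d)} {C1 : ℝ} (hM1 : VertexFamily M1 N C1 δ)
    {M2 : Fin (d + 1) → Site (d + 1) → Fin (d + 1) → Site (d + 1) → MKer (d + 1) (Fib d)} {C2 : ℝ} (hM2 : LocStencilFM N M2 C2 δ)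
    {RM : Site (d + 1) → Fin (d + 1) → Site (d + 1) → MKer (d + 1) (Fib d)} {cH : ℝ} {ρ : Site (d + 1)}
    (hlaw : ∀ (y : Site (d + 1)) (ρ' : Fin (d + 1)) (w : Site (d + 1)),
      cH • ∑ v ∈ box (d + 1) N, divV (fun κ u => M2 κ u ρ' w) ((N : ℤ) • y + toSite v) =
        comp (M1 ρ' w) (diagK (((1 : ℝ) / 2) • ∑ v ∈ box (d + 1) N, legInd ρ ((N : ℤ) • y + toSite v)))
          - comp (diagK (((1 : ℝ) / 2) • ∑ v ∈ box (d + 1) N, legInd ρ ((N : ℤ) • y + toSite v))) (M1 ρ' w) + RM y ρ' w)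
    (T : Finset (Site (d + 1))) (ν : Fin (d + 1)) (y' : Site (d + 1)) :
    BiLoc (∑ y ∈ T, vertexOfM G N (RM y) ν y') ((N : ℤ) • y') ((N : ℤ) • y')
      (((d : ℝ) + 1) * CG * (|cH| * C2 + (1 / 2 : ℝ) * C1 * Real.exp (δ * l1 ρ)) * Zl (d + 1) (δ / 6)
        * ∑ μ : Fin (d + 1),
          (∑ w' ∈ (T.biUnion (fun y => (box (d + 1) N).image (fun v => (N : ℤ) • y + toSite v))).image (fun v => v - unitVec μ)
                \ T.biUnion (fun y => (box (d + 1) N).image (fun v => (N : ℤ) • y + toSite v)), Real.exp (-(δ / 3) * l1 (w' - (N : ℤ) • y'))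
            + ∑ w' ∈ T.biUnion (fun y => (box (d + 1) N).image (fun v => (N : ℤ) • y + toSite v))
                \ (T.biUnion (fun y => (box (d + 1) N).image (fun v => (N : ℤ) • y + toSite v))).image (fun v => v - unitVec μ),
                  Real.exp (-(δ / 3) * l1 (w' - (N : ℤ) • y')))) (δ / 6) :=
  biLoc_sum_vertexOfM_remainder_of_faceW hG hδ hM1 hM2 hlaw T ν y' le_rfl

end Summit.QuantumFields.BalabanUV.Beta.GAN24.LayerLetterMixed

end
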